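import Mathlib
import Summits.NavierStokesRegularity.FluidComputer.TransportGalerkinEmergenceLevels
import HarnessLib

/-!
# Galerkin limit of the transport model, XVII: the KILL twin — residence and the `H²` bound supplied by the chain (instab g19, cell `ns-blowup`, 2026-08-27)

HONEST FRAMING (human ruling D-0035): nothing here is a claim about Navier–Stokes blow-up.
WHAT THIS IS NOT: not NS — a MODEL theorem schema about the host-perturbation equation on `𝕋^d`
in the scaled phase space `E = lp (ℤ^d → V) 2`; no number or census word moves.

PURPOSE. The KILL word (`TransportGalerkinShift.decay_two_nsField_shift`, g18: `‖w t‖ ≤ 2 ε e^{λt}`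
for seeds in the basin, `ω < 2λ ≤ 0`, `ω₁ ≤ λ`) had the same residence inputs (β3) as KEEP. For KILL the
bootstrap's ceiling is the conclusion itself at every level: `‖u n t‖ ≤ 2 ε e^{λt} ≤ 2ε`
(`BoundedGeneratorEmergence.decay_two_of_classical`; truncation does not leave the basin slice since
`‖P_N x‖ ≤ ‖x‖`), so parts IX–X manufacture the box and g18's theorem applies (`decay_two_nsField_of_levels`).
Hypotheses: host (`ν > 0`) + certificates (g18's list) + basin data + the seed `x` rapidly
decreasing and constrained + its Galerkin levels as `C¹` solutions of the finite-dimensional ODE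
keeping the clauses + `w` in the class with a uniform polynomial tail. Part XVIII (`TransportGalerkinAbcKillFinal`)
composes with `TransportGalerkinLevelExistence.exists_level_solution` for forced ABC.
-/

noncomputable section

open scoped ENNReal NNReal ComplexConjugate InnerProductSpace
open Set Filter Topology

namespace Summit.NavierStokesRegularity.FluidComputer.TransportGalerkinKillLevels

open RCLike
open Literature.Analysis.FunctionSpaces Literature.Analysis.FunctionSpaces.Lattice
open Literature.Analysis.FunctionSpaces.Torus
open Literature.Analysis.ODE
open Summit.NavierStokesRegularity.FluidComputer.GalerkinLatticePhaseSpace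
open Summit.NavierStokesRegularity.FluidComputer.TransportGalerkin
open Summit.NavierStokesRegularity.FluidComputer.TransportGalerkinRapid
open Summit.NavierStokesRegularity.FluidComputer.TransportGalerkinBox
open Summit.NavierStokesRegularity.FluidComputer.TransportGalerkinEigen
open Summit.NavierStokesRegularity.FluidComputer.TransportGalerkinLevelGenerators
open Summit.NavierStokesRegularity.FluidComputer.TransportGalerkinBilinearLoss
open Summit.NavierStokesRegularity.FluidComputer.GalerkinCertificateTransfer
open Summit.NavierStokesRegularity.FluidComputer.BoundedGeneratorEmergence
open Summit.NavierStokesRegularity.FluidComputer.TransportGalerkinResidencePrep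
open Summit.NavierStokesRegularity.FluidComputer.TransportGalerkinResidenceBox
open Summit.NavierStokesRegularity.FluidComputer.TransportGalerkinShift
open Summit.NavierStokesRegularity.FluidComputer.TransportGalerkinEmergenceH2

variable {d : Type*} [Fintype d] [DecidableEq d]
variable {V : Type*} [NormedAddCommGroup V] [InnerProductSpace ℂ V] [CompleteSpace V] [ProperSpace V]
variable {ν : ℝ} {Uv : (d → ℤ) → V} {π : d → (V →L[ℂ] ℂ)} {P : (d → ℤ) → (V →L[ℂ] V)}

/-! ## §1 The KILL ceiling holds at EVERY level -/

section LevelBound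

omit [ProperSpace V] in
/-- **The KILL bound at every Galerkin level** (`levelBound_kill`): for the levels `u n` of a seed
`x` in the basin slice (`√(M/m)‖x‖ < ε`, `4Cε < 1`), `‖u n t‖ ≤ 2 ε e^{λt}` on the window for ALL `n`
(`BoundedGeneratorEmergence.decay_two_of_classical` at level `n + K` with the transferred
certificates; `‖P_{n+K} x‖ ≤ ‖x‖`). -/
theorem levelBound_kill (K : ℕ) (hUv : RapidDecay Uv) (hπ : ∀ j, ‖π j‖ ≤ 1) (hPn : ∀ k, ‖P k‖ ≤ 1)
    (hσ : ∑' l : d → ℤ, ENNReal.ofReal (sobolevWeight (-2) l ^ 2) < ∞)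
    {T : ℝ} {x : lp (fun _ : (d → ℤ) => V) 2}
    {u : ℕ → ℝ → lp (fun _ : (d → ℤ) => V) 2}
    (sol_continuousOn : ∀ n, ContinuousOn (u n) (Icc 0 T))
    (sol_init : ∀ n, u n 0 = cubeProj (n + K) x)
    (sol_hasDerivWithinAt : ∀ n, ∀ t ∈ Icc 0 T,
      HasDerivWithinAt (u n) (cubeProj (n + K) (nsField ν Uv π P (u n t))) (Icc 0 T) t)
    (sol_derivCont : ∀ n, ContinuousOn (fun t => cubeProj (n + K) (nsField ν Uv π P (u n t))) (Icc 0 T))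
    (sol_proj : ∀ n, ∀ t ∈ Icc 0 T, cubeProj (n + K) (u n t) = u n t)
    {μ : ℝ}
    {G₁ G₂ G : lp (fun _ : (d → ℤ) => V) 2 →L[ℝ] lp (fun _ : (d → ℤ) => V) 2}
    (hG₁ : ∀ x y : lp (fun _ : (d → ℤ) => V) 2, ⟪G₁ x, y⟫_ℂ = ⟪x, G₁ y⟫_ℂ)
    (hG₂ : ∀ x y : lp (fun _ : (d → ℤ) => V) 2, ⟪G₂ x, y⟫_ℂ = ⟪x, G₂ y⟫_ℂ)
    (hG : ∀ x y : lp (fun _ : (d → ℤ) => V) 2, ⟪G x, y⟫_ℂ = ⟪x, G y⟫_ℂ)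
    (hG₁P : ∀ n, ∀ w z : lp (fun _ : (d → ℤ) => V) 2, ⟪G₁ w, cubeProj (n + K) z⟫_ℂ = ⟪G₁ (cubeProj (n + K) w), z⟫_ℂ)
    (hG₂P : ∀ n, ∀ w z : lp (fun _ : (d → ℤ) => V) 2, ⟪G₂ w, cubeProj (n + K) z⟫_ℂ = ⟪G₂ (cubeProj (n + K) w), z⟫_ℂ)
    (hGP : ∀ n, ∀ w z : lp (fun _ : (d → ℤ) => V) 2, ⟪G w, cubeProj (n + K) z⟫_ℂ = ⟪G (cubeProj (n + K) w), z⟫_ℂ)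
    (hG₁pos : ∀ x : lp (fun _ : (d → ℤ) => V) 2, 0 ≤ re ⟪G₁ x, x⟫_ℂ) {ω c m₂ M₁ : ℝ} (hc : 0 < c)
    (hm₂ : 0 < m₂) (hM₁ : 0 ≤ M₁)
    (hm₂' : ∀ x : lp (fun _ : (d → ℤ) => V) 2, m₂ * ‖x‖ ^ 2 ≤ re ⟪G₂ x, x⟫_ℂ)
    (hM₁' : ∀ x : lp (fun _ : (d → ℤ) => V) 2, re ⟪G₁ x, x⟫_ℂ ≤ M₁ * (eNormSq (-1) (⇑x)).toReal)
    {m M ω₁ : ℝ} (hm0 : 0 < m) (hm : ∀ x : lp (fun _ : (d → ℤ) => V) 2, m * ‖x‖ ^ 2 ≤ re ⟪G x, x⟫_ℂ)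
    (hM : ∀ x : lp (fun _ : (d → ℤ) => V) 2, re ⟪G x, x⟫_ℂ ≤ M * ‖x‖ ^ 2)
    (h₁ : ∀ n, ∀ w : lp (fun _ : (d → ℤ) => V) 2,
      2 * re ⟪G₁ (cubeProj (n + K) w), linOp ν Uv π P (cubeProj (n + K) w)⟫_ℂ + c * re ⟪G₂ (cubeProj (n + K) w), cubeProj (n + K) w⟫_ℂ ≤
        2 * ω * re ⟪G₁ (cubeProj (n + K) w), cubeProj (n + K) w⟫_ℂ)
    (h₂ : ∀ n, ∀ w : lp (fun _ : (d → ℤ) => V) 2,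
      re ⟪G₂ (cubeProj (n + K) w), linOp ν Uv π P (cubeProj (n + K) w)⟫_ℂ ≤ ω * re ⟪G₂ (cubeProj (n + K) w), cubeProj (n + K) w⟫_ℂ)
    (hL : ∀ n, ∀ w : lp (fun _ : (d → ℤ) => V) 2,
      re ⟪G (cubeProj (n + K) w), linOp ν Uv π P (cubeProj (n + K) w)⟫_ℂ ≤ ω₁ * re ⟪G (cubeProj (n + K) w), cubeProj (n + K) w⟫_ℂ)
    (hμ₁ : μ ≤ ω₁) (hμ₂ : μ ≤ ω)
    (htail : ∀ n, ∀ q : lp (fun _ : (d → ℤ) => V) 2, cubeProj (n + K) q = 0 →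
      2 * μ * re ⟪G₁ q, q⟫_ℂ + c * re ⟪G₂ q, q⟫_ℂ ≤ 2 * ω * re ⟪G₁ q, q⟫_ℂ)
    {lam : ℝ} (hgap : ω < 2 * lam) (hlam : lam ≤ 0) (hrate : ω₁ ≤ lam)
    {ε : ℝ} (hε : 0 < ε) (hseed : Real.sqrt (M / m) * ‖x‖ < ε)
    (hbasin : 4 * (Real.sqrt (M₁ / (c * m₂)) * (2 * ((Fintype.card d : ℝ) * (2 * Real.pi)) *
        Real.sqrt ((∑' l : d → ℤ, ENNReal.ofReal (sobolevWeight (-2) l ^ 2)).toReal)) * Real.sqrt (Real.pi / (2 * lam - ω))) * ε < 1)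
 :
    ∀ n, ∀ t ∈ Icc 0 T, ‖u n t‖ ≤ 2 * (ε * Real.exp (lam * t)) := by
  -- the reference weight D = Λ⁻² and the bilinear loss
  obtain ⟨D, hD⟩ := exists_diagWeight (d := d) (V := V)
  have hDP : ∀ n, ∀ w z : lp (fun _ : (d → ℤ) => V) 2,
      ⟪D w, cubeProj (n + K) z⟫_ℂ = ⟪D (cubeProj (n + K) w), z⟫_ℂ := fun n w z => by
    rw [inner_eq_pairing, inner_eq_pairing, hD, hD, pairing_wmul_neg_two_cubeProj]
  have hDre : ∀ x : lp (fun _ : (d → ℤ) => V) 2, re ⟪D x, x⟫_ℂ = (eNormSq (-1) (⇑x)).toReal := fun x => by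
    rw [show re ⟪D x, x⟫_ℂ = (⟪D x, x⟫_ℂ).re from rfl, inner_eq_pairing, hD, re_pairing_wmul_neg_two_self]
  have hDnn : ∀ x : lp (fun _ : (d → ℤ) => V) 2, 0 ≤ re ⟪D x, x⟫_ℂ := fun x => by
    rw [hDre]; exact ENNReal.toReal_nonneg
  have hM₁D : ∀ x : lp (fun _ : (d → ℤ) => V) 2, re ⟪G₁ x, x⟫_ℂ ≤ M₁ * re ⟪D x, x⟫_ℂ := fun x => by
    rw [hDre]; exact hM₁' x
  have hcalg : 0 ≤ 2 * ((Fintype.card d : ℝ) * (2 * Real.pi)) *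
      Real.sqrt ((∑' l : d → ℤ, ENNReal.ofReal (sobolevWeight (-2) l ^ 2)).toReal) := by positivity
  have hG₂pos : ∀ x : lp (fun _ : (d → ℤ) => V) 2, 0 ≤ re ⟪G₂ x, x⟫_ℂ := fun x =>
    le_trans (mul_nonneg hm₂.le (sq_nonneg _)) (hm₂' x)
  have hGpos : ∀ x : lp (fun _ : (d → ℤ) => V) 2, 0 ≤ re ⟪G x, x⟫_ℂ := fun x =>
    le_trans (mul_nonneg hm0.le (sq_nonneg _)) (hm x)
  -- the level generators and the classical form of the levels
  obtain ⟨An, hAn⟩ := exists_levelGenerators (ν := ν) (P := P) hUv hπ hPn μ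
  have hfield : ∀ n, ∀ w ∈ (Set.univ : Set (lp (fun _ : (d → ℤ) => V) 2)), cubeProj (n + K) w = w →
      cubeProj (n + K) (nsField ν Uv π P w) = An (n + K) w + cubeProj (n + K) (bilOp π P w w) :=
    fun n => galerkin_field_ext (𝕜 := ℂ) (fun x _ => nsField_eq ν Uv π P x) (hAn (n + K))
  have hPidem : ∀ n, ∀ w : lp (fun _ : (d → ℤ) => V) 2,
      cubeProj (n + K) (cubeProj (n + K) w) = cubeProj (n + K) w := fun n w => lpProj_idem _ w
  have hB := bilinear_loss hπ hPn hσ hD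
  intro n
  have hderiv : ∀ s ∈ Ioo 0 T,
      HasDerivAt (u n) (An (n + K) (u n s) + cubeProj (n + K) (bilOp π P (u n s) (u n s))) s := by
    intro s hs
    have hsI : s ∈ Icc 0 T := Ioo_subset_Icc_self hs
    have h := (sol_hasDerivWithinAt n s hsI).hasDerivAt (Icc_mem_nhds hs.1 hs.2)
    rw [hfield n (u n s) (Set.mem_univ _) (sol_proj n s hsI)] at h
    exact h
  have hBu : ContinuousOn (fun s => cubeProj (n + K) (bilOp π P (u n s) (u n s))) (Icc 0 T) := by
    have hA : ContinuousOn (fun s => An (n + K) (u n s)) (Icc 0 T) :=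
      (An (n + K)).continuous.comp_continuousOn (sol_continuousOn n)
    refine ((sol_derivCont n).sub hA).congr fun s hs => ?_
    show cubeProj (n + K) (bilOp π P (u n s) (u n s)) =
      cubeProj (n + K) (nsField ν Uv π P (u n s)) - An (n + K) (u n s)
    rw [hfield n (u n s) (Set.mem_univ _) (sol_proj n s hs)]; abel
  -- transferred certificates at level n + K
  have hAn' : ∀ w : lp (fun _ : (d → ℤ) => V) 2,
      An (n + K) w = cubeProj (n + K) (linOp ν Uv π P (cubeProj (n + K) w)) + ((μ : ℂ) • (w - cubeProj (n + K) w)) :=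
    fun w => hAn (n + K) w
  have h₁n := two_level_certificate_ext (𝕜 := ℂ) (hG₁P n) (hG₂P n) (hPidem n) hAn' (htail n) (h₁ n)
  have h₂n := weak_certificate_ext (𝕜 := ℂ) (hG₂P n) (hPidem n) hAn' hμ₂ (fun q _ => hG₂pos q) (h₂ n)
  have hLn := strong_certificate_ext (𝕜 := ℂ) (hGP n) (hPidem n) hAn' hμ₁ (fun q _ => hGpos q) (hL n)
  have hBn := bilinear_loss_proj (𝕜 := ℂ) (hDP n) (hPidem n) (fun q _ => hDnn q) hB
  -- the truncated seed is inside the basin slice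
  have hseed' : Real.sqrt (M / m) * ‖u n 0‖ ≤ ε := by
    rw [sol_init n]
    exact ((mul_le_mul_of_nonneg_left (norm_lpProj_le _ x) (Real.sqrt_nonneg _)).trans hseed.le)
  exact decay_two_of_classical (𝕜 := ℂ) (An (n + K)) (fun x y => cubeProj (n + K) (bilOp π P x y)) hG₁ hG₂
    hG₁pos hc hm₂ hM₁ hm₂' hDnn hM₁D h₁n h₂n hG hm0 hm hM hLn hgap hlam hrate hcalg hBn (sol_continuousOn n) hBu
    hderiv hε hseed' hbasin

end LevelBound

/-! ## §2 KILL with residence and the `H²` bound supplied by the chain -/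

section Kill

/-- **KILL for the model from the certificates, the basin data and the Galerkin ODE alone**
(`decay_two_nsField_of_levels`): the residence inputs of `decay_two_nsField_shift` are replaced by
`ν > 0`, a rapidly decreasing constrained seed `x`, its Galerkin levels as `C¹` solutions of the
finite-dimensional ODE keeping the clauses, and `w` read in the class with a uniform polynomial tail
of scaled order `d + 3` (+ clauses). Conclusion: `‖w t‖ ≤ 2 ε e^{λt}` on the window. -/
theorem decay_two_nsField_of_levels (K : ℕ) (hν : 0 < ν) (hUv : RapidDecay Uv)
    (hUreal : ∀ j p, π j (Uv (-p)) = conj (π j (Uv p)))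
    (hUdiv : ∑ j, freqDeriv j (fun p => π j (Uv p)) = 0) (hπ : ∀ j, ‖π j‖ ≤ 1)
    (hPsa : ∀ k, IsSelfAdjoint (P k)) (hPn : ∀ k, ‖P k‖ ≤ 1)
    (hσ : ∑' l : d → ℤ, ENNReal.ofReal (sobolevWeight (-2) l ^ 2) < ∞)
    {T : ℝ} (hT : 0 ≤ T)
    {x : lp (fun _ : (d → ℤ) => V) 2} (hxr : RapidDecay (⇑x))
    (hxfix : ∀ k, P k (x k) = x k) (hxreal : ∀ j k, π j (x (-k)) = conj (π j (x k)))
    (hxdiv : ∀ k, ∑ j, ((k j : ℤ) : ℂ) * π j (x k) = 0)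
    {u : ℕ → ℝ → lp (fun _ : (d → ℤ) => V) 2}
    (sol_continuousOn : ∀ n, ContinuousOn (u n) (Icc 0 T))
    (sol_init : ∀ n, u n 0 = cubeProj (n + K) x)
    (sol_hasDerivWithinAt : ∀ n, ∀ t ∈ Icc 0 T,
      HasDerivWithinAt (u n) (cubeProj (n + K) (nsField ν Uv π P (u n t))) (Icc 0 T) t)
    (sol_derivCont : ∀ n, ContinuousOn (fun t => cubeProj (n + K) (nsField ν Uv π P (u n t))) (Icc 0 T))
    (sol_proj : ∀ n, ∀ t ∈ Icc 0 T, cubeProj (n + K) (u n t) = u n t)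
    (sol_fix : ∀ n, ∀ t ∈ Icc 0 T, ∀ k, P k ((u n t : (d → ℤ) → V) k) = (u n t : (d → ℤ) → V) k)
    (sol_real : ∀ n, ∀ t ∈ Icc 0 T, ∀ j k,
      π j ((u n t : (d → ℤ) → V) (-k)) = conj (π j ((u n t : (d → ℤ) → V) k)))
    (sol_div : ∀ n, ∀ t ∈ Icc 0 T, ∀ k, ∑ j, ((k j : ℤ) : ℂ) * π j ((u n t : (d → ℤ) → V) k) = 0)
    {μ : ℝ}
    {G₁ G₂ G : lp (fun _ : (d → ℤ) => V) 2 →L[ℝ] lp (fun _ : (d → ℤ) => V) 2}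
    (hG₁ : ∀ x y : lp (fun _ : (d → ℤ) => V) 2, ⟪G₁ x, y⟫_ℂ = ⟪x, G₁ y⟫_ℂ)
    (hG₂ : ∀ x y : lp (fun _ : (d → ℤ) => V) 2, ⟪G₂ x, y⟫_ℂ = ⟪x, G₂ y⟫_ℂ)
    (hG : ∀ x y : lp (fun _ : (d → ℤ) => V) 2, ⟪G x, y⟫_ℂ = ⟪x, G y⟫_ℂ)
    (hG₁P : ∀ n, ∀ w z : lp (fun _ : (d → ℤ) => V) 2, ⟪G₁ w, cubeProj (n + K) z⟫_ℂ = ⟪G₁ (cubeProj (n + K) w), z⟫_ℂ)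
    (hG₂P : ∀ n, ∀ w z : lp (fun _ : (d → ℤ) => V) 2, ⟪G₂ w, cubeProj (n + K) z⟫_ℂ = ⟪G₂ (cubeProj (n + K) w), z⟫_ℂ)
    (hGP : ∀ n, ∀ w z : lp (fun _ : (d → ℤ) => V) 2, ⟪G w, cubeProj (n + K) z⟫_ℂ = ⟪G (cubeProj (n + K) w), z⟫_ℂ)
    (hG₁pos : ∀ x : lp (fun _ : (d → ℤ) => V) 2, 0 ≤ re ⟪G₁ x, x⟫_ℂ) {ω c m₂ M₁ : ℝ} (hc : 0 < c)
    (hm₂ : 0 < m₂) (hM₁ : 0 ≤ M₁)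
    (hm₂' : ∀ x : lp (fun _ : (d → ℤ) => V) 2, m₂ * ‖x‖ ^ 2 ≤ re ⟪G₂ x, x⟫_ℂ)
    (hM₁' : ∀ x : lp (fun _ : (d → ℤ) => V) 2, re ⟪G₁ x, x⟫_ℂ ≤ M₁ * (eNormSq (-1) (⇑x)).toReal)
    {m M ω₁ : ℝ} (hm0 : 0 < m) (hm : ∀ x : lp (fun _ : (d → ℤ) => V) 2, m * ‖x‖ ^ 2 ≤ re ⟪G x, x⟫_ℂ)
    (hM : ∀ x : lp (fun _ : (d → ℤ) => V) 2, re ⟪G x, x⟫_ℂ ≤ M * ‖x‖ ^ 2)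
    (h₁ : ∀ n, ∀ w : lp (fun _ : (d → ℤ) => V) 2,
      2 * re ⟪G₁ (cubeProj (n + K) w), linOp ν Uv π P (cubeProj (n + K) w)⟫_ℂ + c * re ⟪G₂ (cubeProj (n + K) w), cubeProj (n + K) w⟫_ℂ ≤
        2 * ω * re ⟪G₁ (cubeProj (n + K) w), cubeProj (n + K) w⟫_ℂ)
    (h₂ : ∀ n, ∀ w : lp (fun _ : (d → ℤ) => V) 2,
      re ⟪G₂ (cubeProj (n + K) w), linOp ν Uv π P (cubeProj (n + K) w)⟫_ℂ ≤ ω * re ⟪G₂ (cubeProj (n + K) w), cubeProj (n + K) w⟫_ℂ)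
    (hL : ∀ n, ∀ w : lp (fun _ : (d → ℤ) => V) 2,
      re ⟪G (cubeProj (n + K) w), linOp ν Uv π P (cubeProj (n + K) w)⟫_ℂ ≤ ω₁ * re ⟪G (cubeProj (n + K) w), cubeProj (n + K) w⟫_ℂ)
    (hμ₁ : μ ≤ ω₁) (hμ₂ : μ ≤ ω)
    (htail : ∀ n, ∀ q : lp (fun _ : (d → ℤ) => V) 2, cubeProj (n + K) q = 0 →
      2 * μ * re ⟪G₁ q, q⟫_ℂ + c * re ⟪G₂ q, q⟫_ℂ ≤ 2 * ω * re ⟪G₁ q, q⟫_ℂ)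
    {lam : ℝ} (hgap : ω < 2 * lam) (hlam : lam ≤ 0) (hrate : ω₁ ≤ lam)
    {ε : ℝ} (hε : 0 < ε) (hseed : Real.sqrt (M / m) * ‖x‖ < ε)
    (hbasin : 4 * (Real.sqrt (M₁ / (c * m₂)) * (2 * ((Fintype.card d : ℝ) * (2 * Real.pi)) *
        Real.sqrt ((∑' l : d → ℤ, ENNReal.ofReal (sobolevWeight (-2) l ^ 2)).toReal)) * Real.sqrt (Real.pi / (2 * lam - ω))) * ε < 1)
    {w : ℝ → lp (fun _ : (d → ℤ) => V) 2} (hw : ContinuousOn w (Icc 0 T)) (hw0 : w 0 = x)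
    (hw' : ∀ t ∈ Ioo 0 T, HasDerivAt w (nsField ν Uv π P (w t)) t)
    {Cw : ℝ} (hCw : 0 ≤ Cw)
    (hwdec : ∀ t ∈ Icc 0 T, ∀ k, ‖(w t : (d → ℤ) → V) k‖ ≤ Cw * sobolevWeight (-((Fintype.card d : ℝ) + 3)) k)
    (hwfix : ∀ t ∈ Icc 0 T, ∀ k, P k ((w t : (d → ℤ) → V) k) = (w t : (d → ℤ) → V) k)
    (hwreal : ∀ t ∈ Icc 0 T, ∀ j k, π j ((w t : (d → ℤ) → V) (-k)) = conj (π j ((w t : (d → ℤ) → V) k)))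
    (hwdiv : ∀ t ∈ Icc 0 T, ∀ k, ∑ j, ((k j : ℤ) : ℂ) * π j ((w t : (d → ℤ) → V) k) = 0) :
    ∀ t ∈ Icc 0 T, ‖w t‖ ≤ 2 * (ε * Real.exp (lam * t)) := by
  -- the level bound r = 2ε (λ ≤ 0)
  have hbound : ∀ n, ∀ t ∈ Icc 0 T, ‖u n t‖ ≤ 2 * ε := by
    intro n t ht
    have h := levelBound_kill K hUv hπ hPn hσ sol_continuousOn sol_init sol_hasDerivWithinAt sol_derivCont sol_proj
      hG₁ hG₂ hG hG₁P hG₂P hGP hG₁pos hc hm₂ hM₁ hm₂' hM₁' hm0 hm hM h₁ h₂ hL hμ₁ hμ₂ htail hgap hlam hrate hε hseed hbasin n t ht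
    have hexp : Real.exp (lam * t) ≤ 1 := by
      rw [← Real.exp_zero]; exact Real.exp_le_exp.2 (mul_nonpos_of_nonpos_of_nonneg hlam ht.1)
    nlinarith [h, hexp, hε]
  -- the seed under a polynomial floor
  set sd : ℝ := (Fintype.card d : ℝ) + 3 with hsd
  have hxfin : eNormSq sd (⇑x) < ∞ := eNormSq_lt_top_of_rapidDecay hxr _
  set Cx : ℝ := Real.sqrt (eNormSq sd (⇑x)).toReal with hCx
  have hCx0 : 0 ≤ Cx := Real.sqrt_nonneg _
  have hxdec : ∀ k, ‖(x : (d → ℤ) → V) k‖ ≤ Cx * sobolevWeight (-sd) k := fun k =>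
    norm_apply_le_of_eNormSq_le hxfin le_rfl k
  -- initial energies
  set E₃ : ℝ := (eNormSq 3 (wmul (-2) ⇑x)).toReal with hE₃
  set Eσ : ℝ := (eNormSq ((Fintype.card d + 5 : ℕ) : ℝ) (wmul (-2) ⇑x)).toReal with hEσ
  have hxr' : RapidDecay (wmul (-2) (⇑x)) := rapidDecay_wmul hxr (-2)
  have h3 : ∀ n, (eNormSq 3 (wmul (-2) ⇑(u n 0))).toReal ≤ E₃ := fun n => by
    rw [sol_init n, hE₃]
    exact ENNReal.toReal_mono (eNormSq_lt_top_of_rapidDecay hxr' _).ne (eNormSq_unscale_cubeProj_le _ _ _)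
  have hσ0 : ∀ n, (eNormSq ((Fintype.card d + 5 : ℕ) : ℝ) (wmul (-2) ⇑(u n 0))).toReal ≤ Eσ := fun n => by
    rw [sol_init n, hEσ]
    exact ENNReal.toReal_mono (eNormSq_lt_top_of_rapidDecay hxr' _).ne (eNormSq_unscale_cubeProj_le _ _ _)
  have hWr : ∀ n, ∀ t ∈ Icc 0 T, u n t ∈ box (fun _ => 2 * ε) π P := fun n t ht =>
    mem_box.2 ⟨fun k => (norm_apply_le (u n t) k).trans (hbound n t ht), sol_fix n t ht,
      sol_real n t ht, sol_div n t ht⟩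
  have hderiv : ∀ n, ∀ t ∈ Ico 0 T,
      HasDerivWithinAt (u n) (cubeProj (n + K) (nsField ν Uv π P (u n t))) (Ici t) t := by
    intro n t ht
    refine (sol_hasDerivWithinAt n t (Ico_subset_Icc_self ht)).mono_of_mem_nhdsWithin ?_
    exact Set.ordConnected_Icc.mem_nhdsGE (Ico_subset_Icc_self ht) (right_mem_Icc.2 (ht.1.trans ht.2.le)) ht.2
  obtain ⟨ρ, hρ0, hρ1, hρ2, hfloor, hmem⟩ := exists_residence_box (ι := ℕ) (N := fun n => n + K)
    (y := u) (C₀ := Cx + Cw) hν hUv hπ hUreal hUdiv hPsa hPn hσ (by positivity : (0 : ℝ) < 2 * ε)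
    ENNReal.toReal_nonneg ENNReal.toReal_nonneg (add_nonneg hCx0 hCw) sol_continuousOn hderiv sol_proj hWr hbound
    h3 hσ0
  have hxW : x ∈ box ρ π P :=
    mem_box.2 ⟨fun k => (hxdec k).trans ((mul_le_mul_of_nonneg_right (le_add_of_nonneg_right hCw)
      (sobolevWeight_pos _ _).le).trans (hfloor k)), hxfix, hxreal, hxdiv⟩
  have hwW : ∀ t ∈ Icc 0 T, w t ∈ box ρ π P := fun t ht =>
    mem_box.2 ⟨fun k => (hwdec t ht k).trans ((mul_le_mul_of_nonneg_right
      (le_add_of_nonneg_left hCx0) (sobolevWeight_pos _ _).le).trans (hfloor k)),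
      hwfix t ht, hwreal t ht, hwdiv t ht⟩
  exact decay_two_nsField_shift K hν.le hUv hUreal hUdiv hπ hPsa hPn hρ0 hρ1 hρ2
    (Z := {x}) (u := fun n _ => u n) hT (Set.singleton_subset_iff.2 hxW)
    (fun n y hy => sol_continuousOn n) (fun n y hy => by rw [Set.mem_singleton_iff.1 hy]; exact sol_init n)
    (fun n y hy t ht => (sol_hasDerivWithinAt n t (Ioo_subset_Icc_self ht)).hasDerivAt
      (Icc_mem_nhds ht.1 ht.2))
    (fun n y hy t ht => hmem n t ht) (fun n y hy => sol_proj n) hσ hG₁ hG₂ hG hG₁P hG₂P hGP hG₁pos hc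
    hm₂ hM₁ hm₂' hM₁' hm0 hm hM h₁ h₂ hL hμ₁ hμ₂ htail hgap hlam hrate (Set.mem_singleton x) hε hseed hbasin
    hw hw0 hw' hwW

end Kill

end Summit.NavierStokesRegularity.FluidComputer.TransportGalerkinKillLevels

end
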